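import Summits.BirchSwinnertonDyer.BirchSwinnertonDyer.Theorems.ManinLocalTwoThreeDescentTwoStability
import Summits.BirchSwinnertonDyer.BirchSwinnertonDyer.Theorems.ManinLocalTwoThreeVertexTwoStability
import Summits.BirchSwinnertonDyer.BirchSwinnertonDyer.Theorems.ManinLocalTwoThreeExtensionLemmas
import HarnessLib

/-!
# E-es-37 for `j ≥ 2`, part 2a: the element `g = U⁻(2^{j−1}L′)` and the index-`2` pair `Γ₀(2^jL′) ≤ Γ₀(2^{j−1}L′)`
# (MEMO-es §25.9 (D))

Summit `BirchSwinnertonDyer`, route `ManinLocalTwoThree` (cell bsd-f2-manin), crux C2 `ManinOddAtFour` (stmt-BirchSwinnertonDyer-22967),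
line `kato_shift_two` v6, stub 3 (`C₃`-image residual), descent step [D] = E-es-37 at `t = 2`, `j ≥ 2`.  Notation: `N = 2^jL′`,
`N′ = 2^{j−1}L′`, `x = 2^{j−1}L′`, `g = U⁻(x) = (1 0; x 1) ∈ Γ₀(N′) ∖ Γ₀(N)`, `u` a `2`-shift-invariant generalised `λ`-eigen
degree-`0` cocycle on `Γ₀(N)` with hNT(2), `L′` odd, `K` of characteristic `p`.

* `index_gamma0_level_two`: `[Γ₀(N′) : Γ₀(N)] = 2` (`Subgroup.index_eq_two_iff` with `a := g`), and the coset dichotomy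
  `mem_or_lowerUnip_inv_mul_mem`;
* `apply_lowerUnip_sq_eq_zero`: `u(g²) = 0` (no cusp hypothesis: `g² = U⁻(N)` is the `2`-shift of `g⁴ ∈ Γ₀(2N)`, so
  `u(g²) = u(g⁴) = 2u(g²)`);
* `exists_descentTwo_extension`: an additive `Ψ : Γ₀(N′) → K` with `Ψ|Γ₀(N) = u` and `Ψ(g) = 0` — es's `extTwo` (p605692) with
  `y := 0`, the `g`-stability being part 1's `adLowerUnip_invariant` (p607202);
* `descentTwo_apply_lowerUnip_eq`: ANY additive `2`-shift-invariant `Ψ′` on `Γ₀(N′)` has `Ψ′(g) = Ψ′(g²)` (`g` is the `2`-shift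
  of `g²`) — the source of uniqueness;
* `descentTwo_shiftInvariant`: such a `Ψ` (additive, `Ψ|Γ₀(N) = u`, `Ψ(g) = 0`) is `2`-shift-invariant on `Γ₀(N′)`: for
  `δ ∈ Γ₀(2N′) = Γ₀(N)` either `4x ∣ c_δ` (then `AδA⁻¹ ∈ Γ₀(N)` and it is `u`'s shift-invariance) or `AδA⁻¹ = g·A δ₂ A⁻¹` with
  `δ₂ = g⁻²δ ∈ Γ₀(2N)`, so `Ψ(AδA⁻¹) = Ψ(g) + u(δ₂) = u(δ)` (§25.9 (D) verbatim).

Part 3 (`…DescentTwo.lean`): Hecke, cusps, uniqueness, and the packaged `∃!`.  No new definitions; nothing about BSD or Manin's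
conjecture is proved here.

References: K. S. Brown, *Cohomology of Groups*, III.10.3 [cite: Brown1982, III.10.3]; G. Shimura (1971) §8.3
[cite: Shimura1971, §8.3 (8.3.2)]; cell memo HOME/MEMO-es.md §25.9 (D); HOME/p1/NOTES-p1-g2.md (FINAL HANDOFF, extension plan).
-/

set_option autoImplicit false
set_option linter.dupNamespace false

open scoped MatrixGroups

open CongruenceSubgroup Matrix.SpecialLinearGroup Literature.NumberTheory.EllipticCurves.ModularForms
  Literature.NumberTheory.EllipticCurves.ModularForms.HidaCohomology Subgroup

namespace Summit.BirchSwinnertonDyer.BirchSwinnertonDyer.Theorems.ManinLocalTwoThree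

/-! ### The element `g = U⁻(2^{j−1}L′)` and the index-`2` pair `Γ₀(2^jL′) ≤ Γ₀(2^{j−1}L′)` -/

section LowerUnip

variable {L' j : ℕ} [NeZero L'] (hj : 2 ≤ j) {U : SL(2, ℤ)}
  (hU : (U : Matrix (Fin 2) (Fin 2) ℤ) = !![1, 0; (L' : ℤ) * 2 ^ (j - 1), 1])
include hU

omit [NeZero L'] in
/-- Left multiplication by `g = (1 0; x 1)`: `gM = (m₀₀, m₀₁; x m₀₀ + m₁₀, x m₀₁ + m₁₁)`. [folklore] -/
theorem coe_lowerUnip_mul (M : Matrix (Fin 2) (Fin 2) ℤ) :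
    (U : Matrix (Fin 2) (Fin 2) ℤ) * M =
      !![M 0 0, M 0 1; (L' : ℤ) * 2 ^ (j - 1) * M 0 0 + M 1 0, (L' : ℤ) * 2 ^ (j - 1) * M 0 1 + M 1 1] := by
  rw [hU]
  ext i k
  fin_cases i <;> fin_cases k <;> simp [Matrix.mul_apply, Fin.sum_univ_two]

omit [NeZero L'] in
/-- Left multiplication by `g⁻¹ = (1 0; −x 1)`: `g⁻¹M = (m₀₀, m₀₁; −x m₀₀ + m₁₀, −x m₀₁ + m₁₁)`. [folklore] -/
theorem coe_lowerUnip_inv_mul (M : Matrix (Fin 2) (Fin 2) ℤ) :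
    ((U⁻¹ : SL(2, ℤ)) : Matrix (Fin 2) (Fin 2) ℤ) * M =
      !![M 0 0, M 0 1; -((L' : ℤ) * 2 ^ (j - 1)) * M 0 0 + M 1 0, -((L' : ℤ) * 2 ^ (j - 1)) * M 0 1 + M 1 1] := by
  rw [Matrix.SpecialLinearGroup.coe_inv, hU, Matrix.adjugate_fin_two]
  ext i k
  fin_cases i <;> fin_cases k <;> simp [Matrix.mul_apply, Fin.sum_univ_two]

omit [NeZero L'] hU in
/-- The four entries of an element of `SL₂(ℤ)` with known matrix (plumbing). [folklore] -/
theorem sl_entries_of_coe_eq {X : SL(2, ℤ)} {a b c d : ℤ} (h : (X : Matrix (Fin 2) (Fin 2) ℤ) = !![a, b; c, d]) :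
    X 0 0 = a ∧ X 0 1 = b ∧ X 1 0 = c ∧ X 1 1 = d := by
  refine ⟨?_, ?_, ?_, ?_⟩ <;> (show (X : Matrix (Fin 2) (Fin 2) ℤ) _ _ = _; rw [h]; rfl)

omit [NeZero L'] in
/-- `g ∈ Γ₀(2^{j−1}L′)`. [folklore] -/
theorem lowerUnip_mem_Gamma0_half : U ∈ Gamma0 (L' * 2 ^ (j - 1)) := by
  apply mem_Gamma0_of_dvd_apply_one_zero
  show ((L' * 2 ^ (j - 1) : ℕ) : ℤ) ∣ (U : Matrix (Fin 2) (Fin 2) ℤ) 1 0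
  rw [hU]
  push_cast
  simp

include hj

/-- `g ∉ Γ₀(2^jL′)`. [folklore] -/
theorem lowerUnip_not_mem_Gamma0 : U ∉ Gamma0 (L' * 2 ^ j) := by
  intro h
  have hd := natCast_dvd_gamma0_apply_one_zero ⟨U, h⟩
  have hx0 : ((L' : ℤ) * 2 ^ (j - 1)) ≠ 0 := mul_ne_zero (by exact_mod_cast NeZero.ne L') (pow_ne_zero _ two_ne_zero)
  have e : ((⟨U, h⟩ : Gamma0 (L' * 2 ^ j)) : SL(2, ℤ)) 1 0 = (L' : ℤ) * 2 ^ (j - 1) := by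
    show (U : Matrix (Fin 2) (Fin 2) ℤ) 1 0 = _
    rw [hU]; rfl
  rw [e, level_eq_two_mul L' j (by omega)] at hd
  obtain ⟨k, hk⟩ := hd
  have h1 : ((L' : ℤ) * 2 ^ (j - 1)) * 1 = ((L' : ℤ) * 2 ^ (j - 1)) * (2 * k) := by linear_combination hk
  have h2 := mul_left_cancel₀ hx0 h1
  omega

omit [NeZero L'] in
/-- `g² = U⁻(2^jL′) ∈ Γ₀(2^jL′)`. [folklore] -/
theorem lowerUnip_sq_mem_Gamma0 : U * U ∈ Gamma0 (L' * 2 ^ j) := by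
  apply mem_Gamma0_of_dvd_apply_one_zero
  show ((L' * 2 ^ j : ℕ) : ℤ) ∣ ((U : Matrix (Fin 2) (Fin 2) ℤ) * (U : Matrix (Fin 2) (Fin 2) ℤ)) 1 0
  rw [coe_lowerUnip_mul hU, hU, level_eq_two_mul L' j (by omega)]
  simp only [Matrix.of_apply, Matrix.cons_val', Matrix.cons_val_zero, Matrix.cons_val_one, Matrix.empty_val',
    Matrix.cons_val_fin_one]
  exact ⟨1, by ring⟩

omit [NeZero L'] in
/-- **Coset dichotomy**: every `γ ∈ Γ₀(2^{j−1}L′)` lies in `Γ₀(2^jL′)` or in `g·Γ₀(2^jL′)`. [folklore] -/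
theorem mem_or_lowerUnip_inv_mul_mem (γ : SL(2, ℤ)) (hγ : γ ∈ Gamma0 (L' * 2 ^ (j - 1))) :
    γ ∈ Gamma0 (L' * 2 ^ j) ∨ U⁻¹ * γ ∈ Gamma0 (L' * 2 ^ j) := by
  have hN := level_eq_two_mul L' j (by omega)
  have hx2 := two_dvd_half_level L' j hj
  obtain ⟨m, hm⟩ : ((L' : ℤ) * 2 ^ (j - 1)) ∣ γ 1 0 := by
    have h := natCast_dvd_gamma0_apply_one_zero ⟨γ, hγ⟩
    push_cast at h
    exact h
  rcases Int.even_or_odd m with ⟨k, hk⟩ | hmodd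
  · left
    apply mem_Gamma0_of_dvd_apply_one_zero
    rw [hN, hm, hk]
    exact ⟨k, by ring⟩
  · right
    apply mem_Gamma0_of_dvd_apply_one_zero
    show ((L' * 2 ^ j : ℕ) : ℤ) ∣ (((U⁻¹ : SL(2, ℤ)) : Matrix (Fin 2) (Fin 2) ℤ) * (γ : Matrix (Fin 2) (Fin 2) ℤ)) 1 0
    rw [coe_lowerUnip_inv_mul hU, hN]
    simp only [Matrix.of_apply, Matrix.cons_val', Matrix.cons_val_zero, Matrix.cons_val_one, Matrix.empty_val',
      Matrix.cons_val_fin_one]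
    -- `γ₀₀` is odd since `γ₁₀` is even
    have hc2 : (2 : ℤ) ∣ γ 1 0 := by rw [hm]; exact hx2.mul_right m
    obtain ⟨ha, -⟩ := odd_of_det_of_even (det_entries γ) hc2
    obtain ⟨k, hk⟩ := Odd.sub_odd hmodd ha
    show 2 * ((L' : ℤ) * 2 ^ (j - 1)) ∣ -((L' : ℤ) * 2 ^ (j - 1)) * (γ : Matrix (Fin 2) (Fin 2) ℤ) 0 0 + (γ : Matrix (Fin 2) (Fin 2) ℤ) 1 0
    refine ⟨k, ?_⟩
    have hm' : (γ : Matrix (Fin 2) (Fin 2) ℤ) 1 0 = (L' : ℤ) * 2 ^ (j - 1) * m := hm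
    have hk' : m - (γ : Matrix (Fin 2) (Fin 2) ℤ) 0 0 = k + k := hk
    linear_combination hm' + ((L' : ℤ) * 2 ^ (j - 1)) * hk'

/-- **`[Γ₀(2^{j−1}L′) : Γ₀(2^jL′)] = 2`** for `j ≥ 2` (witness `g`). [cite: Shimura1971, §1.6 Prop. 1.43] -/
theorem index_gamma0_level_two : ((Gamma0 (L' * 2 ^ j)).subgroupOf (Gamma0 (L' * 2 ^ (j - 1)))).index = 2 := by
  have hN := level_eq_two_mul L' j (by omega)
  have hx2 := two_dvd_half_level L' j hj
  have hx0 : ((L' : ℤ) * 2 ^ (j - 1)) ≠ 0 := mul_ne_zero (by exact_mod_cast NeZero.ne L') (pow_ne_zero _ two_ne_zero)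
  rw [Subgroup.index_eq_two_iff]
  refine ⟨⟨U, lowerUnip_mem_Gamma0_half hU⟩, fun b ↦ ?_⟩
  rw [mem_subgroupOf, mem_subgroupOf, Subgroup.coe_mul]
  obtain ⟨m, hm⟩ : ((L' : ℤ) * 2 ^ (j - 1)) ∣ (b : SL(2, ℤ)) 1 0 := by
    have h := natCast_dvd_gamma0_apply_one_zero b
    push_cast at h
    exact h
  have hc2 : (2 : ℤ) ∣ (b : SL(2, ℤ)) 1 0 := by rw [hm]; exact hx2.mul_right m
  obtain ⟨-, hd⟩ := odd_of_det_of_even (det_entries (b : SL(2, ℤ))) hc2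
  -- `(b g)₁₀ = b₁₀ + x b₁₁`
  have e : ((b : SL(2, ℤ)) * U : SL(2, ℤ)) 1 0 = (b : SL(2, ℤ)) 1 0 + (b : SL(2, ℤ)) 1 1 * ((L' : ℤ) * 2 ^ (j - 1)) := by
    show ((b : SL(2, ℤ)) * (U : Matrix (Fin 2) (Fin 2) ℤ)) 1 0 = _
    rw [hU]
    simp [Matrix.mul_apply, Fin.sum_univ_two]
  have iffb : (b : SL(2, ℤ)) ∈ Gamma0 (L' * 2 ^ j) ↔ Even m := by
    rw [Gamma0_mem, ZMod.intCast_zmod_eq_zero_iff_dvd, hN, hm]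
    constructor
    · rintro ⟨k, hk⟩
      refine ⟨k, ?_⟩
      have h1 : ((L' : ℤ) * 2 ^ (j - 1)) * m = ((L' : ℤ) * 2 ^ (j - 1)) * (k + k) := by linear_combination hk
      exact mul_left_cancel₀ hx0 h1
    · rintro ⟨k, hk⟩
      exact ⟨k, by rw [hk]; ring⟩
  have iffbg : ((b : SL(2, ℤ)) * U : SL(2, ℤ)) ∈ Gamma0 (L' * 2 ^ j) ↔ Even (m + (b : SL(2, ℤ)) 1 1) := by
    rw [Gamma0_mem, ZMod.intCast_zmod_eq_zero_iff_dvd, hN, e, hm]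
    constructor
    · rintro ⟨k, hk⟩
      refine ⟨k, ?_⟩
      have h1 : ((L' : ℤ) * 2 ^ (j - 1)) * (m + (b : SL(2, ℤ)) 1 1) = ((L' : ℤ) * 2 ^ (j - 1)) * (k + k) := by
        linear_combination hk
      exact mul_left_cancel₀ hx0 h1
    · rintro ⟨k, hk⟩
      exact ⟨k, by linear_combination ((L' : ℤ) * 2 ^ (j - 1)) * hk⟩
  rw [iffb, iffbg]
  rcases Int.even_or_odd m with hme | hmo
  · right
    exact ⟨hme, fun h ↦ (Int.not_even_iff_odd.mpr (hme.add_odd hd)) h⟩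
  · left
    exact ⟨hmo.add_odd hd, fun h ↦ (Int.not_even_iff_odd.mpr hmo) h⟩

end LowerUnip


end Summit.BirchSwinnertonDyer.BirchSwinnertonDyer.Theorems.ManinLocalTwoThree
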